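import Summits.QuantumFields.YangMills.Theses.WeakCouplingMasslessPhase
import Literature.MathematicalPhysics.QuantumLattice.WilsonLoopsProofs
import Literature.MathematicalPhysics.QuantumFieldTheory.U1GinibreComparison

/-!
# Birth skeleton (BC3) for crux `WeakCouplingPerimeterLawD4` (stmt-QuantumFields-19520) — `Lines/birth.lean`

Route `route-QuantumFields-WeakCouplingMasslessPhase` (REFUTATION route of `YangMills`; deciding
theorem `closes : WeakCouplingPerimeterLawD4 → DeconfinedIsMassless → ¬ YangMills`, certified).
This file is the skeleton-aware half of the route's birth certificate for its rank-0 target /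
cone-rank-2 crux (tribunal key risk): it CUTS the crux into two NAMED, REGISTERED obligations and
PROVES that they assemble to the crux BY NAME.  It is not a proof attempt: the two `stub_*`
theorems carry the only `sorry`s of the file; everything else (the passage to infinite-volume
limit states for MIXED representations, the abelian rung, the composition) is proved.

## The crux (verbatim, `Theses/WeakCouplingMasslessPhase.lean`)

    def WeakCouplingPerimeterLawD4 : Prop :=
      ∃ N : ℕ, 2 ≤ N ∧ ∀ r : LatticeRep (Matrix.specialUnitaryGroup (Fin N) ℂ), ∃ βc : ℝ, ∀ β : ℝ, βc < β →
        ∀ μ ∈ infiniteVolumeLimitPoints (d := 4) r.ρ β μ,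
          HasPerimeterLaw μ (fun g => normalisedCharacter N (fundamentalRep (Fin N) g))

(for some `N ≥ 2` and EVERY faithful finite-dimensional unitary `r` — the Wilson action is
`S_r = ∑_p (d_r − Re tr r(U_p))` — there is a coupling `βc(r)` beyond which every infinite-volume
limit state of the `r`-Wilson theory (weak limit along tori of side `L_k + 1 → ∞`) gives the
FUNDAMENTAL rectangular Wilson loops a perimeter-law lower bound
`⟨(1/N) Re tr U_{R×T}⟩_μ ≥ e^{-c(μ)·2(R+T)}`, `R, T ≥ 1`).  This is the Patrascioiu–Seiler
scenario; consensus (and the summit `YangMills`) expects it to be FALSE — the route is honest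
about that (its kill criterion #0 is exactly `¬` this crux at one `(N, r, β > βc)`).

## The cut — "one deconfined torus coupling" + "Griffiths' second inequality in `β`"

The route header's own two-layer plan ("seed-and-propagate": a perimeter law at ONE coupling,
then monotonicity in `β` by a Griffiths–Ginibre correlation inequality) — but typed at the level
where both halves are finite-dimensional integrals over `SU(N)^{edges}` on the tori
`(ℤ/(L+1)ℤ)⁴`, i.e. in the `∀ᶠ L in atTop` form of the tree reduction
`Literature.MathematicalPhysics.QuantumLattice.hasPerimeterLaw_of_eventually` and of the abelian
sibling `torusPerimeterBound_of_ginibre_frohlichSpencer`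
(`Literature/Barriers/QuantumFields/AbelianDeconfinementD4Reduction.lean`):

* `stub_torusDeconfinedSeed` — ∃ `N ≥ 2` ∀ faithful `r` ∃ `β₀ ≥ 0`, `c` such that for all
  `R, T ≥ 1`, eventually in `L`: `e^{-c·2(R+T)} ≤ ⟨W^{fund}_{R×T}⟩_{torus L+1, r, β₀}`.
  ONE deconfined coupling per action, in finite volume (Patrascioiu–Seiler at a single `β₀`;
  the perimeter constant uniform in the loop, the volume threshold allowed to depend on it).
  This is where the physics of the crux lives; it is OPEN and believed false by the consensus
  (area law at every `β`), exactly like the crux — but it is STRICTLY SMALLER than the crux: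
  it says nothing about `β > β₀` (re-entrance is not excluded by it) and nothing about limit
  states.  The abelian analogue is a theorem in print (Fröhlich–Spencer 1982 / Guth 1980 for
  `U(1)₄`, vendored as the named fact `FrohlichSpencerU1PerimeterLawD4`, whose single-`β`
  finite-volume form is `frohlichSpencerU1PerimeterLawD4_iff_single_beta` in
  `Literature/MathematicalPhysics/QuantumFieldTheory/U1WeakCouplingD4SingleBeta.lean`).
* `stub_torusGriffithsMonotone` — for `N ≥ 2`, every faithful `r`, `0 ≤ β₀ ≤ β` and every torus
  loop with `2R ≤ L+1`, `2T ≤ L+1`: `⟨W^{fund}_{R×T}⟩_{L+1, r, β₀} ≤ ⟨W^{fund}_{R×T}⟩_{L+1, r, β}`.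
  Griffiths' SECOND inequality in the coupling for non-abelian lattice gauge theory — a
  classical OPEN problem (no Griffiths–Ginibre inequalities are known for `SU(N)`, `N ≥ 2`);
  its abelian case is Ginibre 1970 (Prop. 3 / Example 4), in the tree as
  `Literature.Probability.LatticeModels.ginibreExpect_reChar_mono`, from which the `U(1)₄`
  torus rung `torusGriffithsMonotone_u1Rung` below is PROVED in three lines (and the free-cube
  version is `zdExpect_u1_wilsonLoop_box_mono_beta` in `U1WeakCouplingD4SingleBeta.lean`).
  Plausibly TRUE (every strong-coupling expansion and every simulation is monotone in `β`),
  numerically killable on small tori, and independent of the truth of the crux.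

The composition `WeakCouplingPerimeterLawD4_of` takes `βc := β₀(r)`: for `β > β₀`, a limit
state `μ` along `L_k + 1 → ∞` and `R, T ≥ 1`, the seed bound at `β₀` holds for all large `L`,
the monotone stub moves it to `β` once `2(R+T) ≤ L`, and the PROVED passage lemma
`le_rectExpectation_fund_of_eventually` (weak convergence of the Wilson measures on the cylinder
observable `W^{fund}_{R×T}`, via `IsInfiniteVolumeLimitAlong` and
`toTorusObservable_wilsonLoopObs_rectWalk` of `WilsonLoopsProofs.lean`) transports the eventual
torus bound to `μ`; `HasPerimeterLaw μ …` is that bound with the same `c`.  The passage is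
proved here rather than stubbed because the tree lemma `hasPerimeterLaw_of_eventually` only
covers loop-representation = action-representation, whereas the crux mixes the action `r.ρ`
with the loop `fundamentalRep (Fin N)`; it is twenty lines of bookkeeping, not an obligation
(no shredding).

## Abelian single-`β` precedent (why this is the natural cut)

For `U(1)₄` the tree proves `frohlichSpencerU1PerimeterLawD4_iff_single_beta`: the perimeter
law for all `β > β₀` is EQUIVALENT to a finite-volume perimeter bound at the single coupling
`β₀`, the propagation being Ginibre's inequality in `β`.  The present skeleton is the literal
`SU(N)`-torus transcription of that equivalence's hard direction, with Ginibre's inequality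
replaced by its conjectural non-abelian counterpart.  So the cut isolates exactly the two
things that separate the Patrascioiu–Seiler scenario from the proved abelian one: a deconfined
coupling (seed) and a non-abelian correlation inequality (monotone).

## Why neither stub is the crux or the summit in disguise (BC3 probes, `Lines/birth.md`)

For each stub `S` the probes `example : S → WeakCouplingPerimeterLawD4`,
`example : S → YangMills` and `example : S → ¬ YangMills`, each by
`intro h; first | exact? | simpa using h | simpa [WeakCouplingPerimeterLawD4] using h | … | aesop`
under `maxHeartbeats 400000`, importing this file's imports but NOT this file, all FAIL
(rc 1, goals unsolved; table in `Lines/birth.md`).  Informally: the seed alone gives the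
perimeter law at ONE coupling, not on a half-line of couplings (the crux quantifies
`∀ β > βc`); the monotone stub alone gives no lower bound anywhere (at `β₀ = 0` the loop
expectation is `0`); neither mentions limit states; and `YangMills` / `¬ YangMills` need the
second crux `DeconfinedIsMassless` (OS reconstruction side) in any case.

## Barriers (placement of the two stubs; catalogue `Literature/Barriers/QuantumFields/`)

* `stub_torusDeconfinedSeed` — `AbelianDeconfinementD4` / `MigdalKadanoffGroupBlindness`:
  outside (they refute group-BLIND confinement techniques; the seed ASSERTS deconfinement for
  `SU(N)` and its abelian twin is the barrier's own input).  `NonabelianCoulombPhaseD5`: outside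
  as a technique barrier, but its `evasions_known` record the consensus that `d = 4` confines at
  every coupling — the seed does not evade that consensus; it is the bet (inherited from the
  route, tribunal key risk).  `PerturbativeInvisibility`: a proof of the seed cannot be
  perturbative (perimeter behaviour of LARGE loops at fixed `β₀` is non-perturbative) — inside
  if attacked by expansion in `1/β₀` alone; the route's named non-perturbative inputs are centre
  symmetry / defect-energy bounds (`FiniteTemperatureDeconfinement`, Borgs–Seiler, whose linear
  thermal window is the ceiling the seed must lift on symmetric tori).
* `stub_torusGriffithsMonotone` — `ToronPlaneAnticorrelation`: INSIDE its technique class if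
  proved factor-by-factor (no product-closed association criterion admits the `SU(N)` Wilson
  factors, PROVED in the tree: `LocalAssociationCriterion.not_forall_admits_plaquetteTerm` with
  the witnesses (W1)/(W2)); the statement itself is a GLOBAL-coupling monotonicity on symmetric
  tori, not a pair-covariance or plane-restricted response, and is not contradicted by (W1)/(W2)
  (see the stub's docstring: plaquette case = a variance by transitivity); evasion = any proof
  must use the total action / torus symmetry / transfer-matrix positivity, not single factors.

## Disproof used

None relevant: `ledger crux ls stmt-QuantumFields-19520` shows no `Disproof.lean`, no
`Negative/` lemma and no dead line for this crux (2026-08-17); `ledger negatives --problem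
QuantumFields` has no statement about weak-coupling perimeter laws.  The route's kill
criterion #0 (`¬ WeakCouplingPerimeterLawD4` at one `(N, r, β)`) would kill `stub_torusDeconfinedSeed`
together with `stub_torusGriffithsMonotone` (their conjunction implies the crux), not either alone.

## Relation to the earlier (unpublished) registration

`planner-type-ee1b64c980-0` registered `stub_deconfinedSeed` / `stub_perimeterMonotone` by
`skeleton check` from its own folder (signatures recorded only as `__Registered.*` abbreviations;
`crux write` was refused to that seat, so no `Lines/` file exists).  Same two-piece idea; the
differences: (i) both pieces are typed on TORI (finite-dimensional, numerically checkable)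
instead of on limit states, (ii) the propagation piece is the standard Griffiths-II inequality
rather than an ad-hoc "perimeter law propagates in `β` for all limit states", (iii) the passage
to limit states is proved, (iv) the signatures are registered in full.  This file supersedes it.

## Check

`lean check Lines/birth.lean --json`: rc 0, errors [], sorries 2 (exactly `stub_torusDeconfinedSeed`,
`stub_torusGriffithsMonotone`), no new axioms; audit: `WeakCouplingPerimeterLawD4_of_stubs`
proves `…WeakCouplingPerimeterLawD4` by name (closed modulo the two stubs),
`WeakCouplingPerimeterLawD4_of` (hypothesis form over `Stmt.*`) closed `true`,
`tendsto_wilsonExpectation_fundLoop`, `le_rectExpectation_fund_of_eventually`,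
`torusGriffithsMonotone_u1Rung` closed `true`.
-/

noncomputable section

namespace Summit.QuantumFields.YangMills.Cruxes.WeakCouplingPerimeterLawD4.Birth

open MeasureTheory Filter Topology
open Literature.MathematicalPhysics
open Literature.MathematicalPhysics.QuantumLattice Literature.MathematicalPhysics.QuantumFieldTheory
open Summit.QuantumFields.YangMills.Theses.WeakCouplingMasslessPhase

/-! ## The two registered obligations -/

/-- **Stub 1 — one deconfined torus coupling (Patrascioiu–Seiler seed, finite volume).**
There are `N ≥ 2` and, for every faithful finite-dimensional unitary representation `r` of
`SU(N)` (Wilson action `S_r`), a coupling `β₀ ≥ 0` and a constant `c` such that for all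
`R, T ≥ 1`, for all sufficiently large `L` (threshold allowed to depend on `R, T`):
`e^{-c·2(R+T)} ≤ ⟨(1/N) Re tr U_{R×T}⟩_{torus (ℤ/(L+1)ℤ)⁴, r, β₀}` (fundamental loop at the
origin in the `(0,1)` plane).  Why plausibly true: only under the Patrascioiu–Seiler scenario
(absence of a confining phase at weak coupling in `d = 4`); the consensus expects an area law
`⟨W⟩ ≤ e^{-σ(β) RT}` at EVERY `β`, which would refute it — but no such bound is proved at any
large `β` for any `N ≥ 2` (that is the confinement problem), so the stub is neither cheaply
provable nor cheaply refutable.  Abelian analogue PROVED in print: Fröhlich–Spencer 1982 /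
Guth 1980 (`FrohlichSpencerU1PerimeterLawD4`, single-`β` finite-volume form
`frohlichSpencerU1PerimeterLawD4_iff_single_beta`).  Size: XL / open problem (the physical
content of the crux at one coupling).  Leans on: `wilsonExpectation`, `wilsonLoop`,
`fundamentalRep`, `LatticeRep` (tree definitions only). -/
theorem stub_torusDeconfinedSeed :
    open Literature.MathematicalPhysics in
    ∃ N : ℕ, 2 ≤ N ∧ ∀ r : QuantumFieldTheory.LatticeRep (Matrix.specialUnitaryGroup (Fin N) ℂ),
      ∃ β₀ c : ℝ, 0 ≤ β₀ ∧ ∀ R T : ℕ, 1 ≤ R → 1 ≤ T → ∀ᶠ L : ℕ in Filter.atTop,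
        Real.exp (-c * (2 * (R + T))) ≤
          QuantumFieldTheory.wilsonExpectation r.ρ β₀
            (QuantumFieldTheory.wilsonLoop (QuantumLattice.fundamentalRep (Fin N))
              (0 : QuantumFieldTheory.Site 4 (L + 1)) 0 1 R T) := by
  sorry

/-- **Stub 2 — Griffiths' second inequality in `β` for the fundamental torus loop (non-abelian
Ginibre).**  For `N ≥ 2`, every faithful unitary `r`, `0 ≤ β₀ ≤ β`, and every torus rectangle
with `2R ≤ L+1`, `2T ≤ L+1`: `⟨W^{fund}_{R×T}⟩_{L+1, r, β₀} ≤ ⟨W^{fund}_{R×T}⟩_{L+1, r, β}` —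
equivalently `d/dβ ⟨W⟩ = ∑_p Cov_β(W^{fund}_{R×T}, Re tr r(U_p)) ≥ 0`.  Why plausibly true:
the leading strong-coupling (character-expansion) behaviour `⟨W⟩ ≈ (a_r β^{m_r})^{RT}` is
increasing, every Monte-Carlo data set is monotone in `β`, its `β₀ = 0` instance is Griffiths'
FIRST inequality `⟨W⟩_β ≥ 0 = ⟨W⟩_0` (also unproved for `N ≥ 2` in this generality), and it
holds for every ABELIAN compact gauge group by Ginibre 1970 (Prop. 3 / Example 4; tree:
`Literature.Probability.LatticeModels.ginibreExpect_reChar_mono`, torus `U(1)₄` rung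
`torusGriffithsMonotone_u1Rung` below, free-cube rung `zdExpect_u1_wilsonLoop_box_mono_beta`).
Why it might fail: no Griffiths–Ginibre inequality is known for non-abelian groups, and the
catalogued barrier `Literature.Barriers.QuantumFields.ToronPlaneAnticorrelation` records that on
small periodic tori non-abelian plaquette energies in COMPLEMENTARY planes are anticorrelated
((W1): one-site torus, every `N ≥ 2`, first order in `β`; (W2): `2⁴`, `SU(3)`, weak coupling,
measured, incl. a negative PLANE-RESTRICTED response `∂⟨Re tr U₀₁⟩/∂β₂₃ < 0`) — so no
product-closed local criterion (FKG / Holley / Ginibre system) can prove this stub, and a proof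
must use the GLOBAL structure: the stub varies the coupling of ALL plaquettes of a SYMMETRIC
torus, for which `d/dβ ⟨W⟩ = Cov_β(W, S_r)`; in the plaquette case `R = T = 1`, `r =`
fundamental this is `Var(S)/(N·#plaquettes) ≥ 0` by plaquette-transitivity of the torus
symmetries (so the only loops living on the tori of sides 2 and 3 are safe), and in the
zero-mode (toron) sector the same plane-averaging turns the response into a variance; the
witnesses (W1)/(W2) therefore do not refute it, but a Monte-Carlo sign of
`Cov(W_{2×2}, S_r) < 0` on `4⁴` at a crossover coupling for some `r` WOULD (cheapest falsifier,
one kit job).  Size: L / classical open problem (Griffiths II for `SU(N)` in the global coupling).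
Leans on: tree definitions only. -/
theorem stub_torusGriffithsMonotone :
    open Literature.MathematicalPhysics in
    ∀ (N : ℕ) (r : QuantumFieldTheory.LatticeRep (Matrix.specialUnitaryGroup (Fin N) ℂ)) (β₀ β : ℝ),
      2 ≤ N → 0 ≤ β₀ → β₀ ≤ β → ∀ (L R T : ℕ), 2 * R ≤ L + 1 → 2 * T ≤ L + 1 →
        QuantumFieldTheory.wilsonExpectation r.ρ β₀
            (QuantumFieldTheory.wilsonLoop (QuantumLattice.fundamentalRep (Fin N))
              (0 : QuantumFieldTheory.Site 4 (L + 1)) 0 1 R T) ≤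
          QuantumFieldTheory.wilsonExpectation r.ρ β
            (QuantumFieldTheory.wilsonLoop (QuantumLattice.fundamentalRep (Fin N))
              (0 : QuantumFieldTheory.Site 4 (L + 1)) 0 1 R T) := by
  sorry

/-! ## Statement abbreviations (for the hypothesis-form composition) -/

namespace Stmt

/-- The statement of `stub_torusDeconfinedSeed`, as a `Prop` (literal copy). -/
abbrev stub_torusDeconfinedSeed : Prop :=
    open Literature.MathematicalPhysics in
    ∃ N : ℕ, 2 ≤ N ∧ ∀ r : QuantumFieldTheory.LatticeRep (Matrix.specialUnitaryGroup (Fin N) ℂ),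
      ∃ β₀ c : ℝ, 0 ≤ β₀ ∧ ∀ R T : ℕ, 1 ≤ R → 1 ≤ T → ∀ᶠ L : ℕ in Filter.atTop,
        Real.exp (-c * (2 * (R + T))) ≤
          QuantumFieldTheory.wilsonExpectation r.ρ β₀
            (QuantumFieldTheory.wilsonLoop (QuantumLattice.fundamentalRep (Fin N))
              (0 : QuantumFieldTheory.Site 4 (L + 1)) 0 1 R T)

/-- The statement of `stub_torusGriffithsMonotone`, as a `Prop` (literal copy). -/
abbrev stub_torusGriffithsMonotone : Prop :=
    open Literature.MathematicalPhysics in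
    ∀ (N : ℕ) (r : QuantumFieldTheory.LatticeRep (Matrix.specialUnitaryGroup (Fin N) ℂ)) (β₀ β : ℝ),
      2 ≤ N → 0 ≤ β₀ → β₀ ≤ β → ∀ (L R T : ℕ), 2 * R ≤ L + 1 → 2 * T ≤ L + 1 →
        QuantumFieldTheory.wilsonExpectation r.ρ β₀
            (QuantumFieldTheory.wilsonLoop (QuantumLattice.fundamentalRep (Fin N))
              (0 : QuantumFieldTheory.Site 4 (L + 1)) 0 1 R T) ≤
          QuantumFieldTheory.wilsonExpectation r.ρ β
            (QuantumFieldTheory.wilsonLoop (QuantumLattice.fundamentalRep (Fin N))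
              (0 : QuantumFieldTheory.Site 4 (L + 1)) 0 1 R T)

end Stmt

/-! ## Proved: passage to infinite-volume limit states for mixed representations -/

/-- **Passage lemma (mixed representations).** Along a sequence of tori realising a limit state
`μ` of the `r`-Wilson theory at coupling `β`, the torus expectations of the FUNDAMENTAL
rectangular loop converge to the loop expectation of `μ`: the loop observable
`wilsonLoopObs χ_fund (rectWalk 0 0 1 R T)` is a bounded continuous cylinder observable, and its
torus pull-back is `wilsonLoop (fundamentalRep (Fin N)) 0 0 1 R T`
(`toTorusObservable_wilsonLoopObs_rectWalk`). [folklore] -/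
theorem tendsto_wilsonExpectation_fundLoop {N : ℕ}
    (r : LatticeRep (Matrix.specialUnitaryGroup (Fin N) ℂ)) {β : ℝ}
    {μ : Measure (LGConfig 4 (Matrix.specialUnitaryGroup (Fin N) ℂ))} {Ls : ℕ → ℕ}
    (hμ : IsInfiniteVolumeLimitAlong (d := 4) r.ρ β Ls μ) (R T : ℕ) :
    Tendsto (fun k : ℕ => wilsonExpectation (L := Ls k + 1) r.ρ β
        (wilsonLoop (fundamentalRep (Fin N)) (0 : QuantumFieldTheory.Site 4 (Ls k + 1)) 0 1 R T))
      atTop (𝓝 (rectExpectation μ (fun g => normalisedCharacter N (fundamentalRep (Fin N) g)) 0 1 R T)) := by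
  have hχ := continuous_normalisedCharacter_comp (N := N) (continuous_fundamentalRep (Fin N))
  have h := hμ.2 (wilsonLoopObs (fun g => normalisedCharacter N (fundamentalRep (Fin N) g))
      (rectWalk (0 : Literature.Probability.LatticeModels.Site 4) 0 1 R T))
    _ (isCylinder_wilsonLoopObs _ _) (continuous_wilsonLoopObs hχ _) (exists_abs_wilsonLoopObs_le hχ _)
  have h0 : ∀ L : ℕ, Literature.Probability.LatticeModels.Torus.proj L
      (0 : Literature.Probability.LatticeModels.Site 4) = 0 :=
    fun L => by funext i; simp [Literature.Probability.LatticeModels.Torus.proj]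
  simp only [toTorusObservable_wilsonLoopObs_rectWalk, h0] at h
  exact h

/-- **Eventual torus lower bounds pass to limit states.** If `a ≤ ⟨W^{fund}_{R×T}⟩_{L+1, r, β}`
for all large `L`, then `a ≤ ⟨W^{fund}_{R×T}⟩_μ` for every `μ ∈ infiniteVolumeLimitPoints r.ρ β`
(limit along a strictly increasing sequence of sides). [folklore] -/
theorem le_rectExpectation_fund_of_eventually {N : ℕ}
    (r : LatticeRep (Matrix.specialUnitaryGroup (Fin N) ℂ)) {β : ℝ}
    {μ : Measure (LGConfig 4 (Matrix.specialUnitaryGroup (Fin N) ℂ))}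
    (hμ : μ ∈ infiniteVolumeLimitPoints (d := 4) r.ρ β) {R T : ℕ} {a : ℝ}
    (h : ∀ᶠ L : ℕ in atTop, a ≤ wilsonExpectation (L := L + 1) r.ρ β
        (wilsonLoop (fundamentalRep (Fin N)) (0 : QuantumFieldTheory.Site 4 (L + 1)) 0 1 R T)) :
    a ≤ rectExpectation μ (fun g => normalisedCharacter N (fundamentalRep (Fin N) g)) 0 1 R T := by
  obtain ⟨Ls, hLs, hlim⟩ := hμ
  exact ge_of_tendsto (tendsto_wilsonExpectation_fundLoop r hlim R T) (hLs.tendsto_atTop.eventually h)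

/-! ## Proved: the abelian rung of Stub 2 (Ginibre 1970) -/

/-- **`U(1)₄` rung of `stub_torusGriffithsMonotone` (BC5-type witness for the monotone half).**
For the Wilson-action `U(1)₄` theory on the torus `(ℤ/(L+1)ℤ)⁴`, `0 ≤ β₀ ≤ β`, every plane and
every rectangle: `⟨W_{R×T}⟩_{L+1, β₀} ≤ ⟨W_{R×T}⟩_{L+1, β}` — both sides are Ginibre expectations of
the real part of a character with constant couplings (`wilsonExpectation_u1_eq_ginibreExpect`),
and Ginibre's inequality is monotonicity in the couplings.  The non-abelian statement of the
stub is exactly this with `Circle, u1Rep` replaced by `SU(N), r / fundamentalRep`.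
[cite: Ginibre1970, Prop. 3 with Example 4] -/
theorem torusGriffithsMonotone_u1Rung (β₀ β : ℝ) (hβ₀ : 0 ≤ β₀) (hβ : β₀ ≤ β) (L : ℕ)
    (i j : Fin 4) (R T : ℕ) :
    wilsonExpectation (L := L + 1) u1Rep β₀ (wilsonLoop u1Rep (0 : QuantumFieldTheory.Site 4 (L + 1)) i j R T) ≤
      wilsonExpectation (L := L + 1) u1Rep β (wilsonLoop u1Rep (0 : QuantumFieldTheory.Site 4 (L + 1)) i j R T) := by
  rw [wilsonExpectation_u1_eq_ginibreExpect, wilsonExpectation_u1_eq_ginibreExpect]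
  exact Literature.Probability.LatticeModels.ginibreExpect_reChar_mono _
    (fun θ => exists_mul_self_eq_u1Config θ) _ _ (fun _ => hβ₀) (fun _ => hβ)

/-! ## The composition -/

/-- **Composition (hypothesis form): seed + Griffiths-in-`β` ⇒ the crux, by name.**
`βc := β₀(r)`; for `β > β₀`, `μ` a limit state, `R, T ≥ 1`: eventually in `L` the seed bound at
`β₀` holds and (once `2(R+T) ≤ L`) the monotone stub moves it to `β`; the proved passage lemma
transports the eventual torus bound to `μ`. -/
theorem WeakCouplingPerimeterLawD4_of (hseed : Stmt.stub_torusDeconfinedSeed)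
    (hmono : Stmt.stub_torusGriffithsMonotone) : WeakCouplingPerimeterLawD4 := by
  obtain ⟨N, hN, hseedN⟩ := hseed
  refine ⟨N, hN, fun r => ?_⟩
  obtain ⟨β₀, c, hβ₀, hc⟩ := hseedN r
  refine ⟨β₀, fun β hβ μ hμ => ⟨c, fun R T hR hT => ?_⟩⟩
  refine le_rectExpectation_fund_of_eventually r hμ ?_
  filter_upwards [hc R T hR hT, eventually_ge_atTop (2 * (R + T))] with L hL hL'
  exact hL.trans (hmono N r β₀ β hN hβ₀ hβ.le L R T (by omega) (by omega))

/-- **Composition (closed form over the registered stubs).** The crux BY NAME from the two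
sorried stubs; its only non-whitelisted axiom is the `sorryAx` of the stubs. -/
theorem WeakCouplingPerimeterLawD4_of_stubs : WeakCouplingPerimeterLawD4 :=
  WeakCouplingPerimeterLawD4_of stub_torusDeconfinedSeed stub_torusGriffithsMonotone

/-- Literal check that the `Stmt.*` abbreviations ARE the stub statements (catches drift). -/
example :
    (open Literature.MathematicalPhysics in
    ∃ N : ℕ, 2 ≤ N ∧ ∀ r : QuantumFieldTheory.LatticeRep (Matrix.specialUnitaryGroup (Fin N) ℂ),
      ∃ β₀ c : ℝ, 0 ≤ β₀ ∧ ∀ R T : ℕ, 1 ≤ R → 1 ≤ T → ∀ᶠ L : ℕ in Filter.atTop,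
        Real.exp (-c * (2 * (R + T))) ≤
          QuantumFieldTheory.wilsonExpectation r.ρ β₀
            (QuantumFieldTheory.wilsonLoop (QuantumLattice.fundamentalRep (Fin N))
              (0 : QuantumFieldTheory.Site 4 (L + 1)) 0 1 R T)) →
    (open Literature.MathematicalPhysics in
    ∀ (N : ℕ) (r : QuantumFieldTheory.LatticeRep (Matrix.specialUnitaryGroup (Fin N) ℂ)) (β₀ β : ℝ),
      2 ≤ N → 0 ≤ β₀ → β₀ ≤ β → ∀ (L R T : ℕ), 2 * R ≤ L + 1 → 2 * T ≤ L + 1 →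
        QuantumFieldTheory.wilsonExpectation r.ρ β₀
            (QuantumFieldTheory.wilsonLoop (QuantumLattice.fundamentalRep (Fin N))
              (0 : QuantumFieldTheory.Site 4 (L + 1)) 0 1 R T) ≤
          QuantumFieldTheory.wilsonExpectation r.ρ β
            (QuantumFieldTheory.wilsonLoop (QuantumLattice.fundamentalRep (Fin N))
              (0 : QuantumFieldTheory.Site 4 (L + 1)) 0 1 R T)) →
    WeakCouplingPerimeterLawD4 :=
  fun h₁ h₂ => WeakCouplingPerimeterLawD4_of h₁ h₂

end Summit.QuantumFields.YangMills.Cruxes.WeakCouplingPerimeterLawD4.Birth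

end
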